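import Summits.PneNP.PneNP.Theses.ConvexRankGates
import Summits.PneNP.PneNP.Theorems.CliqueExtLowerBound.Negative.LoadBearing
import Summits.PneNP.PneNP.Theorems.LinAlgGateBlind.Negative.DetGate
import Summits.PneNP.PneNP.Theorems.LinAlgGateBlind.Negative.CliquePolyDetRepr

/-!
# PneNP / ConvexRankGates — crux `LinAlgGateBlind` (stmt-PneNP-10681), negative side, III:
# ONE GRANK gate computes CLIQUE; the crux implies Valiant-type lower bounds over every field

Negative-side support (standing disprover, `Cruxes/LinAlgGateBlind/Disproof.lean`) for the crux
`LinAlgGateBlind` (no polynomial-size circuit over `{∧₂, ∨₂} ∪ PERM_{m^c} ∪ GRANK_{m^c}` computes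
`CLIQUE(m, ⌈m^δ⌉₊)`):
* `exists_oneGRankGate_of_shadow`, `exists_oneGRankGate_computes_cliqueFn` — any affine
  determinantal representation of size `d` of a polynomial whose shadow is `CLIQUE(m,k)` is ONE
  `GRANK_d` gate computing `CLIQUE(m,k)`; unconditionally ONE GRANK gate over `ℚ` of dimension
  `1 + C(m,k)·#E(K_m)` does (`k ≥ 2`): the dimension bound `d ≤ m^c` of the crux is load-bearing,
  with a one-gate threshold `≤ m^{k+3}`.
* `shadow_hasDetRepr_lowerBound_of_linAlgGateBlind`, `dc_cliquePoly_superpolynomial_of_linAlgGateBlind`,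
  `determinantalComplexity_cliquePoly_of_linAlgGateBlind` — the crux AS TYPED implies, over EVERY
  field and for every `c`, eventually in `m`: no polynomial whose shadow is `CLIQUE(m, ⌈m^δ⌉₊)`
  (wild coefficients allowed), in particular the clique polynomial, has `dc ≤ m^c`. A
  superpolynomial determinantal-complexity lower bound for an explicit VNP family in every
  characteristic (Valiant 1979; best proved explicit bound quadratic, Mignon–Ressayre 2004) is thus a
  COROLLARY of any proof of the crux.
-/

namespace Summit.PneNP.PneNP.Theorems.LinAlgGateBlind.Negative

open Literature.Computability.Complexity Filter MvPolynomial
open Summit.PneNP.PneNP.Theorems.CliqueExtLowerBound.Negative (two_le_ceil_rpow)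

section OneGateCircuits

variable {F : Type} [Field F]

/-- If the shadow of `P` (edge variables enumerated by `eE m`) is `CLIQUE(m,k)`, an affine
determinantal representation of size `d` of `P` is ONE `GRANK_d` gate computing `CLIQUE(m,k)`.
[folklore] -/
theorem exists_oneGRankGate_of_shadow {m k d : ℕ} {P : MvPolynomial (Fin (CliqueLPGate.nE m)) F}
    (hP : ∀ x, (∃ s ∈ P.support, ∀ i ∈ s.support, x ((CliqueLPGate.eE m).symm i) = true) ↔
      cliqueFn m k x = true)
    (h : Literature.Computability.AlgebraicComplexity.HasDetRepr P d) :
    ∃ C : Circuit ((⊤ : SimpleGraph (Fin m)).edgeSet),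
      C.IsOver {g | IsGRankGate d g} ∧ C.size ≤ 1 ∧ C.Computes (cliqueFn m k) := by
  obtain ⟨C, hC, hs, he⟩ :=
    (cktSize_shadow_of_hasDetRepr h fun i => (CliqueLPGate.eE m).symm i).toCircuit
  refine ⟨C, hC, hs, fun x => ?_⟩
  rw [he x]
  apply Bool.eq_iff_iff.2
  rw [decide_eq_true_iff, hP x]

/-- **`CLIQUE(m,k)` is ONE GRANK gate of dimension `d` whenever `dc(CL_{m,k}) ≤ d`** (`k ≥ 2`).
[folklore] -/
theorem exists_oneGRankGate_of_hasDetRepr_cliquePoly {m k d : ℕ} (hk : 2 ≤ k)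
    (h : Literature.Computability.AlgebraicComplexity.HasDetRepr (cliquePoly m F k) d) :
    ∃ C : Circuit ((⊤ : SimpleGraph (Fin m)).edgeSet),
      C.IsOver {g | IsGRankGate d g} ∧ C.size ≤ 1 ∧ C.Computes (cliqueFn m k) :=
  exists_oneGRankGate_of_shadow (shadow_cliquePoly_iff hk) h

/-- **Unconditionally, `CLIQUE(m,k)` is ONE GRANK gate over `ℚ` of dimension `1 + C(m,k)·#E(K_m)`**
(`k ≥ 2`): the dimension bound of the crux cannot be dropped. [folklore] -/
theorem exists_oneGRankGate_computes_cliqueFn (m k : ℕ) (hk : 2 ≤ k) :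
    ∃ C : Circuit ((⊤ : SimpleGraph (Fin m)).edgeSet),
      C.IsOver {g | IsGRankGate (1 + m.choose k * CliqueLPGate.nE m) g} ∧ C.size ≤ 1 ∧
        C.Computes (cliqueFn m k) :=
  exists_oneGRankGate_of_hasDetRepr_cliquePoly hk (hasDetRepr_cliquePoly (F := ℚ) k)

/-- **Support-robust Valiant certificate of the crux.** `LinAlgGateBlind` implies: for its `δ`,
over EVERY field, for every `c`, eventually in `m`, NO polynomial in the edge variables whose
monotone shadow is `CLIQUE(m, ⌈m^δ⌉₊)` (any element of the `k`-clique monomial ideal touching every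
`k`-clique, with arbitrary coefficients) has an affine determinantal representation of size
`≤ m^c` — such a representation would be one small GRANK gate computing CLIQUE. [folklore] -/
theorem shadow_hasDetRepr_lowerBound_of_linAlgGateBlind
    (h : Summit.PneNP.PneNP.Theses.ConvexRankGates.LinAlgGateBlind) :
    ∃ δ : ℝ, 0 < δ ∧ δ < 1 / 2 ∧ ∀ (F : Type) [Field F] (c : ℕ), ∀ᶠ m : ℕ in atTop,
      ∀ d ≤ m ^ c, ∀ P : MvPolynomial (Fin (CliqueLPGate.nE m)) F,
        (∀ x, (∃ s ∈ P.support, ∀ i ∈ s.support, x ((CliqueLPGate.eE m).symm i) = true) ↔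
          cliqueFn m ⌈(m : ℝ) ^ δ⌉₊ x = true) →
        ¬ Literature.Computability.AlgebraicComplexity.HasDetRepr P d := by
  obtain ⟨δ, hδ0, hδ1, hB⟩ := h
  refine ⟨δ, hδ0, hδ1, fun F _ c => ?_⟩
  filter_upwards [hB c, eventually_ge_atTop 1] with m hm h1 d hd P hP hrepr
  obtain ⟨C, hC, hs, hc⟩ := exists_oneGRankGate_of_shadow hP hrepr
  exact hm C (hC.mono fun g hg => Or.inr (Or.inr (IsGRankGate.mono hg hd)))
    (hs.trans (Nat.one_le_pow _ _ h1)) hc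

/-- **Valiant certificate of the crux (determinantal complexity of the clique polynomials).**
`LinAlgGateBlind` implies that for its `δ`, over EVERY field and for every `c`,
`dc(CL_{m, ⌈m^δ⌉₊}) > m^c` eventually in `m`: a superpolynomial determinantal-complexity lower bound
for an explicit VNP family in every characteristic (cf. Valiant 1979; the best proved explicit
bound is quadratic, Mignon–Ressayre 2004) follows from any proof of the crux. [folklore] -/
theorem dc_cliquePoly_superpolynomial_of_linAlgGateBlind
    (h : Summit.PneNP.PneNP.Theses.ConvexRankGates.LinAlgGateBlind) :
    ∃ δ : ℝ, 0 < δ ∧ δ < 1 / 2 ∧ ∀ (F : Type) [Field F] (c : ℕ), ∀ᶠ m : ℕ in atTop,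
      ∀ d ≤ m ^ c,
        ¬ Literature.Computability.AlgebraicComplexity.HasDetRepr (cliquePoly m F ⌈(m : ℝ) ^ δ⌉₊) d := by
  obtain ⟨δ, hδ0, hδ1, hB⟩ := shadow_hasDetRepr_lowerBound_of_linAlgGateBlind h
  refine ⟨δ, hδ0, hδ1, fun F _ c => ?_⟩
  filter_upwards [hB F c, eventually_ge_atTop 2] with m hm h2 d hd
  exact hm d hd _ (shadow_cliquePoly_iff (two_le_ceil_rpow hδ0 h2))

/-- The same in terms of `determinantalComplexity`: `m ^ c < dc (CL_{m, ⌈m^δ⌉₊})` eventually.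
[folklore] -/
theorem determinantalComplexity_cliquePoly_of_linAlgGateBlind
    (h : Summit.PneNP.PneNP.Theses.ConvexRankGates.LinAlgGateBlind) :
    ∃ δ : ℝ, 0 < δ ∧ δ < 1 / 2 ∧ ∀ (F : Type) [Field F] (c : ℕ), ∀ᶠ m : ℕ in atTop,
      m ^ c < Literature.Computability.AlgebraicComplexity.determinantalComplexity
        (cliquePoly m F ⌈(m : ℝ) ^ δ⌉₊) := by
  obtain ⟨δ, hδ0, hδ1, hB⟩ := dc_cliquePoly_superpolynomial_of_linAlgGateBlind h
  refine ⟨δ, hδ0, hδ1, fun F _ c => ?_⟩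
  filter_upwards [hB F c] with m hm
  by_contra hle
  push Not at hle
  exact hm _ hle
    (Literature.Computability.AlgebraicComplexity.hasDetRepr_determinantalComplexity_holds _)

end OneGateCircuits

end Summit.PneNP.PneNP.Theorems.LinAlgGateBlind.Negative
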